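import Mathlib
import Literature.Analysis.FluidPDE.NSQuasipotential
import Literature.Analysis.FluidPDE.Vorticity
import Summits.NavierStokesRegularity.NavierStokesRegularity.Theorems.QuarterLogPincerBeadCensusDefs
import Summits.NavierStokesRegularity.NavierStokesRegularity.Theorems.TypeIQuantSubcubicExp.Negative.BeadCensusThreshold
import HarnessLib

/-!
# Negative lane for ⟨stmt-NavierStokesRegularity-24077⟩ — the `flat_chain` line (S1–S4, G2♭): load-bearing hypotheses
# and the satisfiability window of the two data blocks

Refuter seat ns-afl-r1 (g13), `--supports stmt-NavierStokesRegularity-24077`.  The line `Cruxes/TypeIQuantSubcubicExp/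
Lines/flat_chain.lean` (ns-idea-7 g14; v1 sha16 f65eb919802850cf, v1.1 c4b64a6e18657d31) replaces the a-uniform deposit
G2 `BeadCensus.BPChainRate` by the flat deposit G2♭ and the stubs S1 `LevelConcentration`, S2 `LocalSmoothingL6`,
S3 `TypeIEpoch`, S4 `GoodLevelTransfer` (v1.1: S4′ `RegularBlockTransfer`, from which S4 is derived, plus
β `LightSliceRegular` and the open node `SliceCensus`), which exchange two data blocks at a level scale `s` and depth
divisor `D`:

* the **epoch block** (`EpochBlock Ce D u t₁ s`): on `[t₁ − 4s/D, t₁ − s/D]`, global bounds `|u| ≤ Ce(s/D)^{-1/2}`,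
  `‖∇u‖, |ω| ≤ Ce(s/D)^{-1}`, `‖∇ω‖ ≤ Ce(s/D)^{-3/2}`;
* the **concentration block** (`ConcBlock ρ η D u t₁ x₀ s`): on the same time block,
  `η(s/D)^{-1/2} ≤ ∫_{B(x₀, ρ√(s/D))} |ω|²`.

The Lines file is not importable from `Theorems/`, so the blocks (and v1.1's `RegularBlock`) are INLINED VERBATIM below
(as hypotheses, no new `def`; a faithfulness probe — the displayed Props imply the line's Props by weakening, the block
hypotheses are the line's by `Iff.rfl` — is attached as evidence on the item).  Four kernel facts, all by the rest state
`u ≡ 0` or by a one-line volume count — none bears on the truth of 24077, of the line, or of NS regularity (all OPEN);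
they say which hypothesis carries each stub and in which regime of constants the stubs have content:

1. `goodLevelTransfer_false_without_concBlock` — S4 with its `ConcBlock` hypothesis deleted is FALSE: the rest state is
   a classical solution in the frame, every level of it is good once `a ≥ log(4M^{1+10μ})`
   (`BeadCensus.goodLevel_zero_of_threshold_le`, p716406), it satisfies every epoch bound, and its shell cube mass is
   `0 < c`.  So the concentration block is the ONLY hypothesis of S4 that excludes the rest state: any proof of S4 must
   use it (it is where Tao's (5.7)ᵘ enters).
1′. `regularBlockTransfer_false_without_concBlock` — the same for v1.1's registered stub S4′ (regular block
   `(Cg, Λ₁) = (1, Λ₁)`, `a = log(4Λ₁)`, `R = 4√s₁`).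
2. `levelConcentration_false_without_violator` — S1 with the violator hypothesis `e^{a(n+1)} ≤ |u(t₁,x₀)|√t₁` deleted is
   FALSE: the rest state is Type-I(M) for every `M ≥ 0` and its enstrophy on every ball is `0 < η(s/D)^{-1/2}`.
3. `eta_le_of_epochBlock_of_concBlock` — the two blocks are JOINTLY satisfiable at a scale `s/D > 0` only when
   `η ≤ (4π/3) ρ³ Ce²` (sup bound × ball volume; the Bochner integral's junk value `0` for a non-integrable integrand only
   helps).  Consequence for the line: S4 `GoodLevelTransfer` at constants with `η > (4π/3)ρ³Ce²` is VACUOUSLY true, and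
   in `bpChainRateFlat_of` the pair `(ρ, η)` (from S1) and `Ce` (from S3) are produced independently — if they came out
   incompatible, S1 ∧ S3 alone would already forbid every violator with `n ≥ 1` under Type-I(M) (a Type-I regularity
   statement), so a prover of S1/S3 should expect `η(M) ≤ (4π/3)ρ(M)³Ce(M)²`.

No new definitions, no new axioms, no `sorry`.
-/

set_option linter.dupNamespace false

namespace Summit.NavierStokesRegularity.NavierStokesRegularity.Theorems.TypeIQuantSubcubicExp.Negative.FlatChain

section

open MeasureTheory Set Metric
open scoped ENNReal NNReal
open Literature.Analysis Literature.Analysis.FluidPDE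
open Summit.NavierStokesRegularity.NavierStokesRegularity.Cruxes.TypeIQuantSubcubicExp.BeadCensus
open Summit.NavierStokesRegularity.NavierStokesRegularity.Theorems.TypeIQuantSubcubicExp.Negative.BeadCensus

/-! ## The rest state has no vorticity -/

/-- The curl of the zero field vanishes (`fderiv ℝ 0 = 0`, so every entry of the velocity gradient is `0`). [folklore] -/
theorem curl_zero_apply (x : EuclideanSpace ℝ (Fin 3)) :
    curl (0 : EuclideanSpace ℝ (Fin 3) → EuclideanSpace ℝ (Fin 3)) x = 0 := by
  simp only [curl, fderiv_zero, Pi.zero_apply, zero_apply, PiLp.zero_apply, sub_self]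
  ext k
  fin_cases k <;> simp

/-- The vorticity of the rest state vanishes identically. [folklore] -/
theorem vorticity_zero (t : ℝ) :
    vorticity (0 : ℝ → EuclideanSpace ℝ (Fin 3) → EuclideanSpace ℝ (Fin 3)) t = 0 := by
  funext x
  rw [vorticity_apply, Pi.zero_apply, curl_zero_apply, Pi.zero_apply]

/-- The rest state satisfies every epoch bound with any constant `Ce ≥ 0` at any scale `σ = s/D ≥ 0`
(all four left-hand sides are `0`). -/
theorem epochBounds_zero {Ce σ : ℝ} (hCe : 0 ≤ Ce) (hσ : 0 ≤ σ) (t : ℝ) (x : EuclideanSpace ℝ (Fin 3)) :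
    ‖(0 : ℝ → EuclideanSpace ℝ (Fin 3) → EuclideanSpace ℝ (Fin 3)) t x‖ ≤ Ce * σ ^ (-(1 / 2 : ℝ)) ∧
    ‖fderiv ℝ ((0 : ℝ → EuclideanSpace ℝ (Fin 3) → EuclideanSpace ℝ (Fin 3)) t) x‖ ≤ Ce * σ⁻¹ ∧
    ‖vorticity (0 : ℝ → EuclideanSpace ℝ (Fin 3) → EuclideanSpace ℝ (Fin 3)) t x‖ ≤ Ce * σ⁻¹ ∧
    ‖fderiv ℝ (vorticity (0 : ℝ → EuclideanSpace ℝ (Fin 3) → EuclideanSpace ℝ (Fin 3)) t) x‖ ≤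
      Ce * σ ^ (-(3 / 2 : ℝ)) := by
  refine ⟨?_, ?_, ?_, ?_⟩
  · rw [Pi.zero_apply, Pi.zero_apply, norm_zero]
    exact mul_nonneg hCe (Real.rpow_nonneg hσ _)
  · rw [Pi.zero_apply, fderiv_zero, Pi.zero_apply, norm_zero]
    exact mul_nonneg hCe (inv_nonneg.2 hσ)
  · rw [vorticity_zero, Pi.zero_apply, norm_zero]
    exact mul_nonneg hCe (inv_nonneg.2 hσ)
  · rw [vorticity_zero, fderiv_zero, Pi.zero_apply, norm_zero]
    exact mul_nonneg hCe (Real.rpow_nonneg hσ _)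

/-- The shell cube mass of the rest state is `0`. -/
theorem shellMass_zero (M a t₁ : ℝ) (x₀ : EuclideanSpace ℝ (Fin 3)) (k : ℕ) :
    ∫⁻ x in levelShell M a t₁ x₀ k,
      ‖(0 : ℝ → EuclideanSpace ℝ (Fin 3) → EuclideanSpace ℝ (Fin 3)) t₁ x‖ₑ ^ (3 : ℝ) = 0 := by
  have h3 : (0 : ℝ≥0∞) ^ (3 : ℝ) = 0 := ENNReal.zero_rpow_of_pos (by norm_num)
  simp [h3]

/-- A ratio exponent is always available: `Λ₁ ≤ 2^{10Λ₁}` (so the side condition `Λ₁ ≤ M^{10μ}` of S4 is met at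
`M = 2`, `μ = Λ₁`). -/
theorem le_two_rpow_ten_mul (Λ₁ : ℝ) : Λ₁ ≤ (2 : ℝ) ^ (10 * Λ₁) := by
  have h1 : 10 * Λ₁ * Real.log 2 + 1 ≤ Real.exp (10 * Λ₁ * Real.log 2) := Real.add_one_le_exp _
  have h2 : Real.log 2 * (10 * Λ₁) = 10 * Λ₁ * Real.log 2 := by ring
  rw [Real.rpow_def_of_pos two_pos, h2]
  have h3 := Real.log_two_gt_d9
  rcases le_or_gt Λ₁ 0 with hneg | hpos
  · exact hneg.trans (Real.exp_pos _).le
  · nlinarith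

/-! ## 1. S4 `GoodLevelTransfer`: the concentration block is load-bearing -/

/-- **S4 without its concentration block is false** (witness: the rest state at `M = 2`, `Ce = ρ = η = 1`, `μ = Λ₁`,
`a = log(4·2^{1+10Λ₁})`, `T = t₁ = 1`, `x₀ = 0`, level `1`).  The displayed Prop is `FlatChain.GoodLevelTransfer`
(Lines/flat_chain.lean, f65eb919802850cf) with the single hypothesis `ConcBlock ρ η D u t₁ x₀ (levelScale a t₁ (k+1))`
deleted and `EpochBlock` inlined verbatim. -/
theorem goodLevelTransfer_false_without_concBlock :
    ¬ (∀ M Ce ρ η : ℝ, 1 ≤ M → 1 ≤ Ce → 0 < ρ → 0 < η → ∃ Λ₁ D : ℝ, 1 ≤ Λ₁ ∧ 8 ≤ D ∧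
        ∀ μ a : ℝ, 0 < μ → Λ₁ ≤ M ^ (10 * μ) → 0 ≤ a → ∃ c : ℝ, 0 < c ∧
          ∀ (T t₁ : ℝ) (x₀ : EuclideanSpace ℝ (Fin 3))
            (u : ℝ → EuclideanSpace ℝ (Fin 3) → EuclideanSpace ℝ (Fin 3))
            (p : ℝ → EuclideanSpace ℝ (Fin 3) → ℝ) (k : ℕ),
            (IsClassicalNSSolutionOn (Icc 0 T) 1 0 u p ∧
              ∀ m : ℕ, ∃ C : NNReal, ∀ t ∈ Icc 0 T, eLpNorm (iteratedFDeriv ℝ m (u t)) 2 volume ≤ C) →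
            t₁ ∈ Ioc 0 T → GoodLevel M μ a u t₁ x₀ (k + 1) →
            (∀ t ∈ Icc (t₁ - 4 * (levelScale a t₁ (k + 1) / D)) (t₁ - levelScale a t₁ (k + 1) / D),
              ∀ x : EuclideanSpace ℝ (Fin 3),
                ‖u t x‖ ≤ Ce * (levelScale a t₁ (k + 1) / D) ^ (-(1 / 2 : ℝ)) ∧
                ‖fderiv ℝ (u t) x‖ ≤ Ce * (levelScale a t₁ (k + 1) / D)⁻¹ ∧
                ‖vorticity u t x‖ ≤ Ce * (levelScale a t₁ (k + 1) / D)⁻¹ ∧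
                ‖fderiv ℝ (vorticity u t) x‖ ≤ Ce * (levelScale a t₁ (k + 1) / D) ^ (-(3 / 2 : ℝ))) →
            ENNReal.ofReal c ≤ ∫⁻ x in levelShell M a t₁ x₀ (k + 1), ‖u t₁ x‖ₑ ^ (3 : ℝ)) := by
  intro h
  obtain ⟨Λ₁, D, hΛ₁, hD, h⟩ := h 2 1 1 1 (by norm_num) le_rfl one_pos one_pos
  have ha : 0 ≤ Real.log (4 * (2 : ℝ) ^ (1 + 10 * Λ₁)) := by
    apply Real.log_nonneg
    have : (1 : ℝ) ≤ (2 : ℝ) ^ (1 + 10 * Λ₁) := Real.one_le_rpow (by norm_num) (by linarith)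
    linarith
  obtain ⟨c, hc, h⟩ := h Λ₁ (Real.log (4 * (2 : ℝ) ^ (1 + 10 * Λ₁))) (by linarith) (le_two_rpow_ten_mul Λ₁) ha
  have hσ : 0 ≤ levelScale (Real.log (4 * (2 : ℝ) ^ (1 + 10 * Λ₁))) 1 (0 + 1) / D :=
    div_nonneg (levelScale_port_pos one_pos _).le (by linarith)
  have key := h 1 1 0 0 0 0 (frame_zero 1) ⟨one_pos, le_rfl⟩
    (goodLevel_zero_of_threshold_le two_pos one_pos le_rfl)
    (fun t _ x => epochBounds_zero zero_le_one hσ t x)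
  rw [shellMass_zero, nonpos_iff_eq_zero, ENNReal.ofReal_eq_zero] at key
  exact absurd hc (not_lt.2 key)

/-! ## 1′. S4′ `RegularBlockTransfer` (v1.1's registered stub, from which S4 is derived): same witness -/

/-- **S4′ without its concentration block is false** (witness: the rest state at `M = Ce = ρ = η = Cg = 1`,
`a = log(4Λ₁)`, `T = t₁ = 1`, `x₀ = 0`, level `1`, inner radius `R = 4√s₁`, so that `Λ₁R = e^{a}√s₁`).  The displayed
Prop is `FlatChain.RegularBlockTransfer` (Lines/flat_chain.lean v1.1, c4b64a6e18657d31) with the single hypothesis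
`ConcBlock ρ η D u t₁ x₀ (levelScale a t₁ (k+1))` deleted and `RegularBlock` / `EpochBlock` inlined verbatim.  Since
S4 is S4′ specialised (`goodLevelTransfer_of_regularBlockTransfer`), this is the v1.1 form of § 1. -/
theorem regularBlockTransfer_false_without_concBlock :
    ¬ (∀ M Ce ρ η Cg : ℝ, 1 ≤ M → 1 ≤ Ce → 0 < ρ → 0 < η → 1 ≤ Cg → ∃ Λ₁ D : ℝ, 1 ≤ Λ₁ ∧ 8 ≤ D ∧
        ∀ a : ℝ, 0 ≤ a → ∃ c : ℝ, 0 < c ∧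
          ∀ (T t₁ : ℝ) (x₀ : EuclideanSpace ℝ (Fin 3))
            (u : ℝ → EuclideanSpace ℝ (Fin 3) → EuclideanSpace ℝ (Fin 3))
            (p : ℝ → EuclideanSpace ℝ (Fin 3) → ℝ) (k : ℕ),
            (IsClassicalNSSolutionOn (Icc 0 T) 1 0 u p ∧
              ∀ m : ℕ, ∃ C : NNReal, ∀ t ∈ Icc 0 T, eLpNorm (iteratedFDeriv ℝ m (u t)) 2 volume ≤ C) →
            t₁ ∈ Ioc 0 T →
            (∃ R : ℝ, 4 * M * Real.sqrt (levelScale a t₁ (k + 1)) ≤ R ∧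
              Λ₁ * R ≤ Real.exp a * Real.sqrt (levelScale a t₁ (k + 1)) ∧
              ∀ t ∈ Icc (t₁ - levelScale a t₁ (k + 1) / 32) t₁, ∀ x : EuclideanSpace ℝ (Fin 3),
                R < ‖x - x₀‖ → ‖x - x₀‖ < Λ₁ * R →
                ∀ j : ℕ, j ≤ 2 →
                  ‖iteratedFDeriv ℝ j (u t) x‖ ≤ Cg * (levelScale a t₁ (k + 1)) ^ (-(((j : ℝ) + 1) / 2))) →
            (∀ t ∈ Icc (t₁ - 4 * (levelScale a t₁ (k + 1) / D)) (t₁ - levelScale a t₁ (k + 1) / D),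
              ∀ x : EuclideanSpace ℝ (Fin 3),
                ‖u t x‖ ≤ Ce * (levelScale a t₁ (k + 1) / D) ^ (-(1 / 2 : ℝ)) ∧
                ‖fderiv ℝ (u t) x‖ ≤ Ce * (levelScale a t₁ (k + 1) / D)⁻¹ ∧
                ‖vorticity u t x‖ ≤ Ce * (levelScale a t₁ (k + 1) / D)⁻¹ ∧
                ‖fderiv ℝ (vorticity u t) x‖ ≤ Ce * (levelScale a t₁ (k + 1) / D) ^ (-(3 / 2 : ℝ))) →
            ENNReal.ofReal c ≤ ∫⁻ x in levelShell M a t₁ x₀ (k + 1), ‖u t₁ x‖ₑ ^ (3 : ℝ)) := by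
  intro h
  obtain ⟨Λ₁, D, hΛ₁, hD, h⟩ := h 1 1 1 1 1 le_rfl le_rfl one_pos one_pos le_rfl
  have h4 : 0 < 4 * Λ₁ := by linarith
  have ha : 0 ≤ Real.log (4 * Λ₁) := Real.log_nonneg (by linarith)
  obtain ⟨c, hc, h⟩ := h (Real.log (4 * Λ₁)) ha
  have hs : 0 < levelScale (Real.log (4 * Λ₁)) 1 (0 + 1) := levelScale_port_pos one_pos _
  have hσ : 0 ≤ levelScale (Real.log (4 * Λ₁)) 1 (0 + 1) / D := div_nonneg hs.le (by linarith)
  have key := h 1 1 0 0 0 0 (frame_zero 1) ⟨one_pos, le_rfl⟩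
    ⟨4 * 1 * Real.sqrt (levelScale (Real.log (4 * Λ₁)) 1 (0 + 1)), le_rfl,
      by rw [Real.exp_log h4]; exact le_of_eq (by ring), by
      intro t _ x _ _ j _
      have h0 : iteratedFDeriv ℝ j
          ((0 : ℝ → (EuclideanSpace ℝ (Fin 3)) → (EuclideanSpace ℝ (Fin 3))) t) x = 0 := by
        rw [Pi.zero_apply, Pi.zero_def, iteratedFDeriv_fun_zero, Pi.zero_apply]
      rw [h0, norm_zero, one_mul]
      exact Real.rpow_nonneg hs.le _⟩
    (fun t _ x => epochBounds_zero zero_le_one hσ t x)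
  rw [shellMass_zero, nonpos_iff_eq_zero, ENNReal.ofReal_eq_zero] at key
  exact absurd hc (not_lt.2 key)

/-! ## 2. S1 `LevelConcentration`: the violator is load-bearing -/

/-- **S1 without its violator hypothesis is false** (witness: the rest state, Type-I(M) for `M = 1`, `T = τ = t₁ = 1`,
`n = 1`, level `k = 0`; its enstrophy on any ball is `0`).  The displayed Prop is `FlatChain.LevelConcentration` with the
single hypothesis `Real.exp (a * (n + 1)) ≤ ‖u t₁ x₀‖ * Real.sqrt t₁` deleted and `ConcBlock` inlined verbatim. -/
theorem levelConcentration_false_without_violator :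
    ¬ (∀ M : ℝ, ∃ ρ η : ℝ, 0 < ρ ∧ 0 < η ∧ ∀ D : ℝ, 8 ≤ D → ∃ a₁ : ℝ, 0 < a₁ ∧ ∀ a : ℝ, a₁ ≤ a →
        ∀ (T τ t₁ : ℝ) (x₀ : EuclideanSpace ℝ (Fin 3))
          (u : ℝ → EuclideanSpace ℝ (Fin 3) → EuclideanSpace ℝ (Fin 3))
          (p : ℝ → EuclideanSpace ℝ (Fin 3) → ℝ) (n : ℕ),
          (IsClassicalNSSolutionOn (Icc 0 T) 1 0 u p ∧
            ∀ m : ℕ, ∃ C : NNReal, ∀ t ∈ Icc 0 T, eLpNorm (iteratedFDeriv ℝ m (u t)) 2 volume ≤ C) →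
          0 < τ →
          (∀ t ∈ Icc 0 T, ∀ x : EuclideanSpace ℝ (Fin 3), ‖u t x‖ ≤ M * (T + τ - t) ^ (-(1 / 2 : ℝ))) →
          t₁ ∈ Ioc 0 T →
          ∀ k : ℕ, k < n →
            ∀ t ∈ Icc (t₁ - 4 * (levelScale a t₁ (k + 1) / D)) (t₁ - levelScale a t₁ (k + 1) / D),
              η * (levelScale a t₁ (k + 1) / D) ^ (-(1 / 2 : ℝ)) ≤
                ∫ x in ball x₀ (ρ * Real.sqrt (levelScale a t₁ (k + 1) / D)), ‖vorticity u t x‖ ^ 2) := by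
  intro h
  obtain ⟨ρ, η, hρ, hη, h⟩ := h 1
  obtain ⟨a₁, ha₁, h⟩ := h 8 le_rfl
  have hσ : 0 < levelScale a₁ 1 (0 + 1) / 8 := div_pos (levelScale_port_pos one_pos _) (by norm_num)
  have key := h a₁ le_rfl 1 1 1 0 0 0 1 (frame_zero 1) one_pos (typeI_zero zero_le_one one_pos)
    ⟨one_pos, le_rfl⟩ 0 one_pos (1 - 4 * (levelScale a₁ 1 (0 + 1) / 8))
    ⟨le_rfl, by linarith⟩
  have hint : ∫ x in ball (0 : EuclideanSpace ℝ (Fin 3)) (ρ * Real.sqrt (levelScale a₁ 1 (0 + 1) / 8)),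
      ‖vorticity (0 : ℝ → EuclideanSpace ℝ (Fin 3) → EuclideanSpace ℝ (Fin 3))
        (1 - 4 * (levelScale a₁ 1 (0 + 1) / 8)) x‖ ^ 2 = 0 := by
    simp [curl_zero_apply]
  rw [hint] at key
  have hpos : 0 < η * (levelScale a₁ 1 (0 + 1) / 8) ^ (-(1 / 2 : ℝ)) :=
    mul_pos hη (Real.rpow_pos_of_pos hσ _)
  linarith

/-! ## 3. The satisfiability window of the two blocks -/

/-- **Volume count.**  If at ONE time `t` the vorticity is pointwise bounded by `Ce σ⁻¹` and the enstrophy on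
`B(x₀, ρ√σ)` is at least `η σ^{-1/2}` (`σ > 0`, `ρ ≥ 0`), then `η ≤ (4π/3) ρ³ Ce²`. -/
theorem eta_le_of_pointwise_of_enstrophy {Ce ρ η σ : ℝ} {x₀ : EuclideanSpace ℝ (Fin 3)}
    {ω : EuclideanSpace ℝ (Fin 3) → EuclideanSpace ℝ (Fin 3)} (hρ : 0 ≤ ρ) (hσ : 0 < σ)
    (hω : ∀ x : EuclideanSpace ℝ (Fin 3), ‖ω x‖ ≤ Ce * σ⁻¹)
    (hconc : η * σ ^ (-(1 / 2 : ℝ)) ≤ ∫ x in ball x₀ (ρ * Real.sqrt σ), ‖ω x‖ ^ 2) :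
    η ≤ 4 / 3 * Real.pi * ρ ^ 3 * Ce ^ 2 := by
  have hr : 0 ≤ ρ * Real.sqrt σ := mul_nonneg hρ (Real.sqrt_nonneg _)
  -- sup bound × volume
  have hbound : ∀ x ∈ ball x₀ (ρ * Real.sqrt σ), ‖‖ω x‖ ^ 2‖ ≤ (Ce * σ⁻¹) ^ 2 := by
    intro x _
    rw [Real.norm_of_nonneg (sq_nonneg _)]
    exact pow_le_pow_left₀ (norm_nonneg _) (hω x) 2
  have hvol : (volume (ball x₀ (ρ * Real.sqrt σ))).toReal = (ρ * Real.sqrt σ) ^ 3 * (Real.pi * 4 / 3) := by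
    rw [EuclideanSpace.volume_ball_fin_three, ENNReal.toReal_mul, ← ENNReal.ofReal_pow hr,
      ENNReal.toReal_ofReal (pow_nonneg hr 3), ENNReal.toReal_ofReal (by positivity)]
  have hfin : volume (ball x₀ (ρ * Real.sqrt σ)) < ∞ := by
    rw [EuclideanSpace.volume_ball_fin_three]
    exact ENNReal.mul_lt_top (ENNReal.pow_lt_top ENNReal.ofReal_lt_top) ENNReal.ofReal_lt_top
  have hI : ∫ x in ball x₀ (ρ * Real.sqrt σ), ‖ω x‖ ^ 2 ≤ (Ce * σ⁻¹) ^ 2 * ((ρ * Real.sqrt σ) ^ 3 * (Real.pi * 4 / 3)) := by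
    have h1 := norm_setIntegral_le_of_norm_le_const hfin hbound
    rw [Measure.real, hvol] at h1
    exact (le_abs_self _).trans (by simpa [Real.norm_eq_abs] using h1)
  -- algebra: (√σ)³ = σ · √σ and σ⁻² σ √σ = σ^{-1/2} · … ; divide by σ^{-1/2} > 0
  have hsq : Real.sqrt σ ^ 2 = σ := Real.sq_sqrt hσ.le
  have hs3 : (ρ * Real.sqrt σ) ^ 3 = ρ ^ 3 * (σ * Real.sqrt σ) := by
    rw [mul_pow]; congr 1; rw [pow_succ, hsq]
  have hrpow : σ ^ (-(1 / 2 : ℝ)) = (Real.sqrt σ)⁻¹ := by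
    rw [Real.rpow_neg hσ.le, Real.sqrt_eq_rpow]
  have hsqpos : 0 < Real.sqrt σ := Real.sqrt_pos.2 hσ
  rw [hrpow] at hconc
  rw [hs3] at hI
  have hchain := hconc.trans hI
  -- hchain : η * (√σ)⁻¹ ≤ (Ce * σ⁻¹)^2 * (ρ^3 * (σ * √σ) * (π * 4 / 3))
  have hσne : σ ≠ 0 := hσ.ne'
  have key : η ≤ (Ce * σ⁻¹) ^ 2 * (ρ ^ 3 * (σ * Real.sqrt σ) * (Real.pi * 4 / 3)) * Real.sqrt σ := by
    have := mul_le_mul_of_nonneg_right hchain hsqpos.le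
    rwa [mul_assoc, inv_mul_cancel₀ hsqpos.ne', mul_one] at this
  have hss : Real.sqrt σ * Real.sqrt σ = σ := Real.mul_self_sqrt hσ.le
  have hone : σ⁻¹ * σ⁻¹ * σ * (Real.sqrt σ * Real.sqrt σ) = 1 := by
    rw [hss, show σ⁻¹ * σ⁻¹ * σ * σ = (σ⁻¹ * σ) * (σ⁻¹ * σ) by ring, inv_mul_cancel₀ hσne, one_mul]
  have hrew : (Ce * σ⁻¹) ^ 2 * (ρ ^ 3 * (σ * Real.sqrt σ) * (Real.pi * 4 / 3)) * Real.sqrt σ =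
      4 / 3 * Real.pi * ρ ^ 3 * Ce ^ 2 := by
    calc (Ce * σ⁻¹) ^ 2 * (ρ ^ 3 * (σ * Real.sqrt σ) * (Real.pi * 4 / 3)) * Real.sqrt σ
        = Ce ^ 2 * ρ ^ 3 * (Real.pi * 4 / 3) * (σ⁻¹ * σ⁻¹ * σ * (Real.sqrt σ * Real.sqrt σ)) := by ring
      _ = 4 / 3 * Real.pi * ρ ^ 3 * Ce ^ 2 := by rw [hone]; ring
  rw [hrew] at key
  exact key

/-- **The two blocks are jointly satisfiable only for `η ≤ (4π/3)ρ³Ce²`.**  The displayed hypotheses are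
`FlatChain.EpochBlock Ce D u t₁ s` and `FlatChain.ConcBlock ρ η D u t₁ x₀ s` inlined verbatim; `0 < s/D`, `0 ≤ ρ`.
Hence S4 `GoodLevelTransfer` has content only in that window of constants (outside it, it is vacuously true). -/
theorem eta_le_of_epochBlock_of_concBlock {Ce ρ η D t₁ s : ℝ} {x₀ : EuclideanSpace ℝ (Fin 3)}
    {u : ℝ → EuclideanSpace ℝ (Fin 3) → EuclideanSpace ℝ (Fin 3)} (hρ : 0 ≤ ρ) (hsD : 0 < s / D)
    (hE : ∀ t ∈ Icc (t₁ - 4 * (s / D)) (t₁ - s / D), ∀ x : EuclideanSpace ℝ (Fin 3),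
      ‖u t x‖ ≤ Ce * (s / D) ^ (-(1 / 2 : ℝ)) ∧ ‖fderiv ℝ (u t) x‖ ≤ Ce * (s / D)⁻¹ ∧
        ‖vorticity u t x‖ ≤ Ce * (s / D)⁻¹ ∧ ‖fderiv ℝ (vorticity u t) x‖ ≤ Ce * (s / D) ^ (-(3 / 2 : ℝ)))
    (hC : ∀ t ∈ Icc (t₁ - 4 * (s / D)) (t₁ - s / D),
      η * (s / D) ^ (-(1 / 2 : ℝ)) ≤ ∫ x in ball x₀ (ρ * Real.sqrt (s / D)), ‖vorticity u t x‖ ^ 2) :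
    η ≤ 4 / 3 * Real.pi * ρ ^ 3 * Ce ^ 2 := by
  have ht : t₁ - s / D ∈ Icc (t₁ - 4 * (s / D)) (t₁ - s / D) := ⟨by linarith, le_rfl⟩
  exact eta_le_of_pointwise_of_enstrophy hρ hsD (fun x => ((hE _ ht x).2.2.1)) (hC _ ht)

end

end Summit.NavierStokesRegularity.NavierStokesRegularity.Theorems.TypeIQuantSubcubicExp.Negative.FlatChain
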